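import Summits.MatrixMultiplication.OmegaCensus.DicyclicLawClassification
import HarnessLib

/-!
# `Dih(A)` attains the mod-one law when `A` is cyclic or `A/⟨c⟩` is cyclic for an involution `c`

ω-census, family (b3).  Framing: lottery ticket; floor = certified bounds/negative ranges.

The '⟸' direction of the census classification for the generalized DIHEDRAL groups (`c₀ = 0`), as abstract statements
about any dihedral-like presentation `ρ, τ : A → G` with `τa τb = ρ(b − a)` (`|A| ≡ 1 (mod 3)`):
* `dih_mod_one_law_attained_of_cyclic`: `A = ⟨g⟩` ⇒ a TPP triple with `3|S||T||U| + 8 = 8|A|` exists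
  (`A ≃+ ℤ_N`, `G ≃* G(ℤ_N, 0) ≃* D_{2N}`, `dihedral_law`);
* `dih_mod_one_law_attained_of_quot_cyclic`: `c ≠ 0 = 2c` and `A = ⟨g⟩ ∪ (c + ⟨g⟩)` ⇒ the same (if `c ∈ ⟨g⟩` the group is
  cyclic; otherwise `A ≃+ ℤ₂ × ℤ_m` with `c ↦ (1,0)` by `exists_addEquiv_prod_of_not_mem`, and `G ≃* G(ℤ₂ × ℤ_m, (0,0)) =
  C₂ × D_{2m}` attains by `z2zn_mod_one_law_attained` with `ε = 0`).
These cover every `A` with a cyclic subgroup of index `≤ 2` (`ℤ_N`; `ℤ₂ × ℤ_m` via its involution `(1,0)`); the concrete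
forms were `dihedral_law` / `c2_dihedral_law`.  Tools: `DihedralLikeGroup.equivOfPresentation`, `congr`,
`exists_tpp_volume_of_mulEquiv` (gen 8).
-/

namespace Summit.MatrixMultiplication.OmegaCensus

open Literature.Combinatorics.Additive Finset

section Dih

variable {A : Type} [AddCommGroup A] [DecidableEq A] [Fintype A] {G : Type} [Group G] [DecidableEq G]
  {ρ τ : A → G}

/-- `0 + 0 = 0` as a `Fact`, so that `DihedralLikeGroup A 0` is a group. [folklore] -/
instance fact_zero_add_zero (A : Type) [AddCommGroup A] : Fact ((0 : A) + 0 = 0) := ⟨add_zero 0⟩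

omit [DecidableEq A] in
/-- A cyclic `A` of order `N` is `≃+ ℤ_N` (any parity). [folklore] -/
theorem exists_addEquiv_zmod_of_cyclic' {g : A} (hg : ∀ x : A, x ∈ AddSubgroup.zmultiples g) :
    Nonempty (A ≃+ ZMod (Fintype.card A)) := by
  haveI : NeZero (Fintype.card A) := ⟨Fintype.card_ne_zero⟩
  let ψ : ZMod (Fintype.card A) →+ A := ZMod.lift (Fintype.card A) ⟨zmultiplesHom A g, by
    show ((Fintype.card A : ℕ) : ℤ) • g = 0
    rw [natCast_zsmul]; exact card_nsmul_eq_zero⟩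
  have hψ : ∀ k : ℤ, ψ (k : ZMod (Fintype.card A)) = k • g := fun k => by
    show ZMod.lift (Fintype.card A) _ (k : ZMod (Fintype.card A)) = _; rw [ZMod.lift_coe]; rfl
  have hsurj : Function.Surjective ψ := by
    intro x
    obtain ⟨k, hk⟩ := AddSubgroup.mem_zmultiples_iff.1 (hg x)
    exact ⟨(k : ZMod (Fintype.card A)), by rw [hψ, hk]⟩
  have hbij : Function.Bijective ψ :=
    (Fintype.bijective_iff_surjective_and_card _).2 ⟨hsurj, by rw [ZMod.card]⟩
  exact ⟨(AddEquiv.ofBijective ψ hbij).symm⟩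

/-- `D_{2N} = DihedralGroup N ≃* G(ℤ_N, 0)`. [folklore] -/
noncomputable def dihedralEquivModel (N : ℕ) : DihedralLikeGroup (ZMod N) 0 ≃* DihedralGroup N :=
  DihedralLikeGroup.equivOfPresentation (ρ := DihedralGroup.r) (τ := DihedralGroup.sr) DihedralGroup.r_mul_r
    DihedralGroup.r_mul_sr DihedralGroup.sr_mul_r (fun a b => by rw [DihedralGroup.sr_mul_sr, zero_add])
    (fun _ _ h => by cases h; rfl) (fun _ _ h => by cases h; rfl) (fun _ _ h => by cases h) (fun g => by
      cases g with
      | r i => exact Or.inl ⟨i, rfl⟩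
      | sr i => exact Or.inr ⟨i, rfl⟩)

omit [DecidableEq A] in
/-- **`Dih(A)`, `A` cyclic, `|A| ≡ 1 (mod 3)`, `|A| ≥ 3`: the mod-one law is attained.** [folklore] -/
theorem dih_mod_one_law_attained_of_cyclic
    (hρρ : ∀ a b, ρ a * ρ b = ρ (a + b)) (hρτ : ∀ a b, ρ a * τ b = τ (b - a))
    (hτρ : ∀ a b, τ a * ρ b = τ (a + b)) (hττ : ∀ a b, τ a * τ b = ρ ((0 : A) + b - a))
    (hρ : Function.Injective ρ) (hτ : Function.Injective τ) (hne : ∀ a b, ρ a ≠ τ b)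
    (hsurj : ∀ g, (∃ a, ρ a = g) ∨ (∃ a, τ a = g)) (hmod : Fintype.card A % 3 = 1) (hA : 3 ≤ Fintype.card A)
    {g : A} (hg : ∀ x : A, x ∈ AddSubgroup.zmultiples g) :
    ∃ S T U : Finset G, TripleProductProperty S T U ∧ 3 * (S.card * T.card * U.card) + 8 = 8 * Fintype.card A := by
  haveI : NeZero (Fintype.card A) := ⟨Fintype.card_ne_zero⟩
  obtain ⟨φ⟩ := exists_addEquiv_zmod_of_cyclic' hg
  let eG : DihedralLikeGroup A 0 ≃* G := DihedralLikeGroup.equivOfPresentation hρρ hρτ hτρ hττ hρ hτ hne hsurj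
  let e := ((DihedralLikeGroup.congr (c₀ := (0 : A)) (c₀' := (0 : ZMod (Fintype.card A))) φ (map_zero φ)).trans
    (dihedralEquivModel (Fintype.card A))).symm.trans eG
  obtain ⟨S, T, U, h, -, -, -, hvol⟩ := dihedral_volume_ge_law (Fintype.card A) hA
  obtain ⟨S', T', U', h', hV'⟩ := exists_tpp_volume_of_mulEquiv e ⟨S, T, U, h, rfl⟩
  exact ⟨S', T', U', h', by rw [hV', hvol]; omega⟩

/-- **`Dih(A)` with `A = ⟨g⟩ ∪ (c + ⟨g⟩)` for an involution `c` (`|A| ≡ 1 (mod 3)`, `|A| ≥ 6`): the mod-one law is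
attained.**  (`c ∈ ⟨g⟩`: cyclic case; `c ∉ ⟨g⟩`: `A ≃+ ℤ₂ × ℤ_m`, `G ≃* C₂ × D_{2m}`.) [folklore] -/
theorem dih_mod_one_law_attained_of_quot_cyclic
    (hρρ : ∀ a b, ρ a * ρ b = ρ (a + b)) (hρτ : ∀ a b, ρ a * τ b = τ (b - a))
    (hτρ : ∀ a b, τ a * ρ b = τ (a + b)) (hττ : ∀ a b, τ a * τ b = ρ ((0 : A) + b - a))
    (hρ : Function.Injective ρ) (hτ : Function.Injective τ) (hne : ∀ a b, ρ a ≠ τ b)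
    (hsurj : ∀ g, (∃ a, ρ a = g) ∨ (∃ a, τ a = g)) (hmod : Fintype.card A % 3 = 1) (hA : 6 ≤ Fintype.card A)
    {c g : A} (h2c : c + c = 0)
    (hg : ∀ x : A, x ∈ AddSubgroup.zmultiples g ∨ x + c ∈ AddSubgroup.zmultiples g) :
    ∃ S T U : Finset G, TripleProductProperty S T U ∧ 3 * (S.card * T.card * U.card) + 8 = 8 * Fintype.card A := by
  by_cases hcg : c ∈ AddSubgroup.zmultiples g
  · exact dih_mod_one_law_attained_of_cyclic hρρ hρτ hτρ hττ hρ hτ hne hsurj hmod (by omega)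
      (cyclic_of_quot_cyclic_of_double (a := c) (c₀ := c + c) rfl (by rw [h2c, add_zero]) (fun x => by
        rcases hg x with hx | hx
        · exact Or.inl hx
        · right; rw [← add_assoc]; exact (AddSubgroup.zmultiples g).add_mem hx hcg))
  · obtain ⟨φ, -, hcard⟩ := exists_addEquiv_prod_of_not_mem hg hcg h2c
    haveI : NeZero (addOrderOf g) := ⟨(addOrderOf_pos g).ne'⟩
    let eG : DihedralLikeGroup A 0 ≃* G := DihedralLikeGroup.equivOfPresentation hρρ hρτ hτρ hττ hρ hτ hne hsurj
    let e := (DihedralLikeGroup.congr (c₀ := (0 : A)) (c₀' := ((0 : ZMod 2), (0 : ZMod (addOrderOf g)))) φ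
      (map_zero φ)).symm.trans eG
    obtain ⟨S, T, U, h, hV⟩ := z2zn_mod_one_law_attained (n := addOrderOf g) (ε := 0) (by omega) (by omega)
    obtain ⟨S', T', U', h', hV'⟩ := exists_tpp_volume_of_mulEquiv e ⟨S, T, U, h, rfl⟩
    refine ⟨S', T', U', h', ?_⟩
    rw [hV', hcard]; rw [Fintype.card_prod, ZMod.card, ZMod.card] at hV; exact hV

end Dih

end Summit.MatrixMultiplication.OmegaCensus
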